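import Literature.Analysis.Moments.SymmetricStieltjesCone
import Literature.Algebra.Polynomial.PolyaSzegoHalfLine

/-!
# Stub `stub_momentCone` of the crux `BrascampLiebVacuum` (line `SketchIdeator2`)

Crux item stmt-QuantumFields-8779, route `ConvexGribovBody` of `YangMills`. The registered stub is
the closed-cone form of the truncated symmetric Stieltjes moment problem: a symmetric real sequence
on `{0,…,2S+1}` whose two Hankel forms of order `S` are non-negative is approximated to any
accuracy by finite non-negative combinations of the pair sequences `u ↦ (q^u + q^{2S+1-u})/2`,
`q ∈ [0,1]`. It is the composition of two Literature theorems: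
`Literature.Analysis.Moments.symmHankel_approx_pairCone_of` (cone separation + Riesz functional,
conditional on the half-line Positivstellensatz) and
`Literature.Algebra.Polynomial.polyaSzego_halfLine` (the Positivstellensatz, Pólya–Szegő).
-/

open scoped BigOperators

namespace Summit.QuantumFields.YangMills.Theorems.BrascampLiebVacuum

/-- **Stub `stub_momentCone` (truncated symmetric Stieltjes moment cone, closed form).** For `s`
symmetric on `{0,…,2S+1}` with both Hankel forms of order `S` non-negative and every `ε > 0` there
are `t_k ≥ 0`, `q_k ∈ [0,1]` (`k < n`) with `|s_u - Σ_k t_k (q_k^u + q_k^{2S+1-u})/2| ≤ ε` for all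
`u ≤ 2S+1`. [folklore] -/
theorem stub_momentCone :
    ∀ (S : ℕ) (s : ℕ → ℝ), (∀ u ≤ 2 * S + 1, s u = s (2 * S + 1 - u)) →
      (∀ a : ℕ → ℝ, 0 ≤ ∑ i ∈ Finset.range (S + 1), ∑ j ∈ Finset.range (S + 1),
        a i * a j * s (i + j)) →
      (∀ a : ℕ → ℝ, 0 ≤ ∑ i ∈ Finset.range (S + 1), ∑ j ∈ Finset.range (S + 1),
        a i * a j * s (i + j + 1)) →
      ∀ ε : ℝ, 0 < ε →
        ∃ (n : ℕ) (t q : ℕ → ℝ), (∀ k < n, 0 ≤ t k) ∧ (∀ k < n, 0 ≤ q k ∧ q k ≤ 1) ∧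
          ∀ u ≤ 2 * S + 1,
            |s u - ∑ k ∈ Finset.range n, t k * ((q k ^ u + q k ^ (2 * S + 1 - u)) / 2)| ≤ ε :=
  fun S s hsym hH0 hH1 ε hε =>
    Literature.Analysis.Moments.symmHankel_approx_pairCone_of S
      (fun P h1 h2 => Literature.Algebra.Polynomial.polyaSzego_halfLine S P h1 h2)
      s hsym hH0 hH1 ε hε

end Summit.QuantumFields.YangMills.Theorems.BrascampLiebVacuum
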